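import Literature.ModelTheory.FiniteModelTheory.CohomologicalConsistencyClosure
import Literature.ModelTheory.FiniteModelTheory.CohomologicalConsistencyThreeColouringProofs
import HarnessLib

/-!
# The neighbourhood structure of a closed vertex set and the monochromatic-star colouring
# (Conneryd–Ghannane–Pang 2025, Lemma 6.8 = [CdRNPR25, Lemma 6.5]: the combinatorial half)

Topic `Literature/ModelTheory/FiniteModelTheory`.  Bottom-up formalisation of the named fact
`connerydGhannanePang2025_thm_6_1` (arXiv:2511.17272 Thm. 6.1): the REDUCIBILITY hypothesis of
`graphCohomologicallyKConsistent_of_reducible` is discharged (in `…Reducibility.lean`) by the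
substitution argument of the reduction lemma of Conneryd–de Rezende–Nordström–Pang–Risse, whose
printed proof (FOCS 2023 version, Lemmas 4.6 and 5.4; READ) we follow.  This file contains its
graph-theoretic half.  Throughout `J ⊆ X` are vertex sets of a linearly ordered graph `G` with `J`
CLOSED (`IsClosed`, Def. 6.6 of the source: descendant-closed, no `2,3,4`-hops, no lassos).

* `nbr G J X` (`N = N_{X∖J}(J)`), `uOf` (THE neighbour in `J` of `v ∈ N` — unique as there are no
  `2`-hops, and SMALLER than `v` as `J` is descendant-closed: `uOf_spec`, `eq_uOf`, `uOf_lt`),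
  `far G J X` (`A = X ∖ (J ∪ N)`), `leaves G J X v` (`M_v = N_A(v)`, the star of `v`).
  Structure [CdRNPR, proof of Lemma 5.4, "Note the following property of the strong closure"]:
  `N` is independent (`nbr_independent`, no `3`-hops), the stars are disjoint
  (`leaves_disjoint`, no `4`-hops), each star is independent (`leaves_independent`, no lassos),
  a vertex of `N` has no neighbours in `X` other than `uOf v` and its leaves
  (`adj_cases_of_mem_nbr`), and `A` has no neighbours in `J` (`not_adj_of_mem_far`).
* `starGraph` (`G'`): the graph on the representatives `R = (A ∖ ⋃ M_v) ∪ N` in which `v ∈ N`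
  stands for its star; `starGraph_isSparse`: if `G` is `(ℓ, ε)`-sparse, `|X| ≤ ℓ` and degrees are
  `≤ Δ`, then `G'` is `(|V|, ε(Δ+1))`-sparse [CdRNPR, (5.1)–(5.2), with `≥` in place of `=` for the
  edge count, which makes `5`-hops and `6`-lassos unnecessary];
* `exists_starColouring`: for `ε(Δ+1) < 1/2` there is a proper `3`-colouring `ρ` of `G[A]` in
  which every star `M_v` is MONOCHROMATIC, of colour `κ v` [CdRNPR, proof of Lemma 5.4: colour `G'`
  by Lemma 2.2 = `IsSparse.exists_proper_three` and expand].

## References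

* [ConnerydGhannanePang2025] arXiv:2511.17272 §6, Lemma 6.8 and Def. 6.6. READ.
* J. Conneryd, S. F. de Rezende, J. Nordström, S. Pang, K. Risse, *Graph Colouring Is Hard on
  Average for Polynomial Calculus and Nullstellensatz*, FOCS 2023, Lemmas 4.6, 5.4 (proofs). READ
  (galaxy pdf:3983998057739619720); cited as [CdRNPR25] (full version) by the source.
-/

namespace Literature.ModelTheory.FiniteModelTheory

namespace ConnerydGhannanePang

open Finset

variable {V : Type*} [LinearOrder V] (G : SimpleGraph V) [DecidableRel G.Adj] (J X : Finset V)

/-! ### The three zones `J`, `N`, `A` -/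

/-- `N = N_{X∖J}(J)`: the vertices of `X` outside `J` with a neighbour in `J`.
[cite: ConnerydGhannanePang2025, Lemma 6.8 (proof via [CdRNPR25, Lemma 6.5])] -/
def nbr : Finset V :=
  X.filter fun v => v ∉ J ∧ ∃ u ∈ J, G.Adj u v

/-- `A = X ∖ (J ∪ N)`: the vertices of `X` outside `J` without neighbours in `J`.
[cite: ConnerydGhannanePang2025, Lemma 6.8 (proof via [CdRNPR25, Lemma 6.5])] -/
def far : Finset V :=
  X.filter fun v => v ∉ J ∧ ∀ u ∈ J, ¬ G.Adj u v

/-- THE neighbour of `v` in `J` (some chosen one; unique when `J` has no `2`-hops; `v` itself if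
there is none). [cite: ConnerydGhannanePang2025, Lemma 6.8 (proof)] -/
noncomputable def uOf (v : V) : V :=
  if h : ∃ u ∈ J, G.Adj u v then Classical.choose h else v

/-- The STAR (set of leaves) of `v`: its neighbours in `A` (`M_v`).
[cite: ConnerydGhannanePang2025, Lemma 6.8 (proof via [CdRNPR25, Lemma 5.4 proof])] -/
def leaves (v : V) : Finset V :=
  (far G J X).filter fun w => G.Adj v w

/-- All leaves `⋃_{v ∈ N} M_v`. [folklore] -/
def allLeaves : Finset V :=
  (nbr G J X).biUnion (leaves G J X)

variable {G J X}

/-- Membership in `N`. [folklore] -/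
theorem mem_nbr {v : V} : v ∈ nbr G J X ↔ v ∈ X ∧ v ∉ J ∧ ∃ u ∈ J, G.Adj u v := by
  rw [nbr, Finset.mem_filter]

/-- Membership in `A`. [folklore] -/
theorem mem_far {v : V} : v ∈ far G J X ↔ v ∈ X ∧ v ∉ J ∧ ∀ u ∈ J, ¬ G.Adj u v := by
  rw [far, Finset.mem_filter]

/-- Membership in a star. [folklore] -/
theorem mem_leaves {v w : V} : w ∈ leaves G J X v ↔ w ∈ far G J X ∧ G.Adj v w := by
  rw [leaves, Finset.mem_filter]

/-- Membership in `⋃ M_v`. [folklore] -/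
theorem mem_allLeaves {w : V} : w ∈ allLeaves G J X ↔ ∃ v ∈ nbr G J X, w ∈ leaves G J X v := by
  rw [allLeaves, Finset.mem_biUnion]

/-- `N` and `A` are disjoint. [folklore] -/
theorem not_mem_far_of_mem_nbr {v : V} (hv : v ∈ nbr G J X) : v ∉ far G J X := by
  intro h
  obtain ⟨-, -, u, huJ, huv⟩ := mem_nbr.1 hv
  exact (mem_far.1 h).2.2 u huJ huv

/-- A vertex of `X` outside `J` lies in `N` or in `A`. [folklore] -/
theorem mem_nbr_or_mem_far {v : V} (hvX : v ∈ X) (hvJ : v ∉ J) : v ∈ nbr G J X ∨ v ∈ far G J X := by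
  by_cases h : ∃ u ∈ J, G.Adj u v
  · exact Or.inl (mem_nbr.2 ⟨hvX, hvJ, h⟩)
  · push Not at h
    exact Or.inr (mem_far.2 ⟨hvX, hvJ, h⟩)

/-- `uOf v` is a neighbour of `v ∈ N` in `J`. [folklore] -/
theorem uOf_spec {v : V} (hv : v ∈ nbr G J X) : uOf G J v ∈ J ∧ G.Adj (uOf G J v) v := by
  obtain ⟨-, -, h⟩ := mem_nbr.1 hv
  unfold uOf
  rw [dif_pos h]
  exact Classical.choose_spec h

/-- No `2`-hops: the neighbour in `J` of a vertex outside `J` is unique. [cite: ConnerydGhannanePang2025, Def. 6.6 (2-hops)] -/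
theorem eq_uOf (hJ : IsClosed G J) {v u : V} (hv : v ∈ nbr G J X) (hu : u ∈ J) (huv : G.Adj u v) :
    u = uOf G J v := by
  obtain ⟨hu', hu'v⟩ := uOf_spec hv
  by_contra hne
  exact hJ.no_hop2 hu hu' (mem_nbr.1 hv).2.1 hne huv hu'v.symm

/-- Descendant-closedness: the neighbour in `J` of `v ∈ N` is SMALLER than `v`.
[cite: ConnerydGhannanePang2025, Def. 6.6 (`U = Desc(U)`)] -/
theorem uOf_lt (hJ : IsClosed G J) {v : V} (hv : v ∈ nbr G J X) : uOf G J v < v := by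
  obtain ⟨hu, huv⟩ := uOf_spec hv
  rcases lt_trichotomy (uOf G J v) v with h | h | h
  · exact h
  · exact absurd (h ▸ hu) (mem_nbr.1 hv).2.1
  · exact absurd (hJ.desc hu huv h) (mem_nbr.1 hv).2.1

/-- No `3`-hops: `N` is an independent set. [cite: ConnerydGhannanePang2025, Def. 6.6 (3-hops)] -/
theorem nbr_independent (hJ : IsClosed G J) {v v' : V} (hv : v ∈ nbr G J X) (hv' : v' ∈ nbr G J X)
    (h : G.Adj v v') : False := by
  obtain ⟨hu, huv⟩ := uOf_spec hv
  obtain ⟨hu', hu'v'⟩ := uOf_spec hv'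
  have hvJ := (mem_nbr.1 hv).2.1
  have hv'J := (mem_nbr.1 hv').2.1
  by_cases heq : uOf G J v = uOf G J v'
  · exact hJ.no_hop3Cycle hu hvJ hv'J huv h (heq ▸ hu'v').symm
  · exact hJ.no_hop3Path hu hu' hvJ hv'J heq huv h hu'v'.symm

/-- `A` has no neighbours in `J`. [folklore] -/
theorem not_adj_of_mem_far {z u : V} (hz : z ∈ far G J X) (hu : u ∈ J) : ¬ G.Adj u z :=
  (mem_far.1 hz).2.2 u hu

/-- No `4`-hops: the stars of distinct vertices of `N` are disjoint.
[cite: ConnerydGhannanePang2025, Def. 6.6 (4-hops)] -/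
theorem leaves_disjoint (hJ : IsClosed G J) {v v' w : V} (hv : v ∈ nbr G J X) (hv' : v' ∈ nbr G J X)
    (hw : w ∈ leaves G J X v) (hw' : w ∈ leaves G J X v') : v = v' := by
  by_contra hne
  obtain ⟨hu, huv⟩ := uOf_spec hv
  obtain ⟨hu', hu'v'⟩ := uOf_spec hv'
  have hvJ := (mem_nbr.1 hv).2.1
  have hv'J := (mem_nbr.1 hv').2.1
  have hwJ : w ∉ J := (mem_far.1 (mem_leaves.1 hw).1).2.1
  have e₁ : G.Adj v w := (mem_leaves.1 hw).2
  have e₂ : G.Adj v' w := (mem_leaves.1 hw').2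
  by_cases heq : uOf G J v = uOf G J v'
  · exact hJ.hop4Cycle ⟨uOf G J v, v, w, v', hu, hvJ, hwJ, hv'J, hne, huv, e₁, e₂.symm,
      (heq ▸ hu'v').symm⟩
  · exact hJ.hop4Path ⟨uOf G J v, v, w, v', uOf G J v', hu, hu', hvJ, hwJ, hv'J, heq, hne, huv, e₁,
      e₂.symm, hu'v'.symm⟩

/-- No lassos: each star is an independent set. [cite: ConnerydGhannanePang2025, Def. 6.6 (lassos)] -/
theorem leaves_independent (hJ : IsClosed G J) {v w w' : V} (hv : v ∈ nbr G J X)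
    (hw : w ∈ leaves G J X v) (hw' : w' ∈ leaves G J X v) (h : G.Adj w w') : False := by
  obtain ⟨hu, huv⟩ := uOf_spec hv
  exact hJ.lasso ⟨uOf G J v, v, w, w', hu, (mem_nbr.1 hv).2.1,
    (mem_far.1 (mem_leaves.1 hw).1).2.1, (mem_far.1 (mem_leaves.1 hw').1).2.1, huv,
    (mem_leaves.1 hw).2, h, (mem_leaves.1 hw').2.symm⟩

/-- The neighbours in `X` of a vertex `v ∈ N`: its neighbour in `J` and its leaves.
[cite: ConnerydGhannanePang2025, Lemma 6.8 (proof)] -/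
theorem adj_cases_of_mem_nbr (hJ : IsClosed G J) {v z : V} (hv : v ∈ nbr G J X) (hz : z ∈ X)
    (h : G.Adj v z) : (z ∈ J ∧ z = uOf G J v) ∨ z ∈ leaves G J X v := by
  by_cases hzJ : z ∈ J
  · exact Or.inl ⟨hzJ, eq_uOf hJ hv hzJ h.symm⟩
  · rcases mem_nbr_or_mem_far (G := G) hz hzJ with hzN | hzA
    · exact (nbr_independent hJ hv hzN h).elim
    · exact Or.inr (mem_leaves.2 ⟨hzA, h⟩)

variable (G J X) in
/-- THE CENTRE of a leaf: the `v ∈ N` whose star contains it (unique by `leaves_disjoint`);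
the identity off `⋃ M_v`. [folklore] -/
noncomputable def centre (w : V) : V :=
  if h : ∃ v ∈ nbr G J X, w ∈ leaves G J X v then Classical.choose h else w

/-- The centre of a leaf. [folklore] -/
theorem centre_eq (hJ : IsClosed G J) {v w : V} (hv : v ∈ nbr G J X) (hw : w ∈ leaves G J X v) :
    centre G J X w = v := by
  have h : ∃ v ∈ nbr G J X, w ∈ leaves G J X v := ⟨v, hv, hw⟩
  unfold centre
  rw [dif_pos h]
  obtain ⟨hv', hw'⟩ := Classical.choose_spec h
  exact leaves_disjoint hJ hv' hv hw' hw

/-- The centre of a non-leaf is itself. [folklore] -/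
theorem centre_of_not_mem {w : V} (hw : w ∉ allLeaves G J X) : centre G J X w = w := by
  unfold centre
  rw [dif_neg]
  exact fun ⟨v, hv, hwv⟩ => hw (mem_allLeaves.2 ⟨v, hv, hwv⟩)

/-! ### The star graph `G'` on the representatives -/

variable (G J X) in
/-- The REPRESENTATIVES `R = (A ∖ ⋃ M_v) ∪ N`: `v ∈ N` represents its star `M_v`, the other
vertices of `A` represent themselves. [cite: ConnerydGhannanePang2025, Lemma 6.8 (proof via [CdRNPR25])] -/
def reps : Finset V :=
  (far G J X \ allLeaves G J X) ∪ nbr G J X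

variable (G J X) in
/-- `Rel p p'`: the vertex `p' ∈ A` is represented by `p ∈ R`. [folklore] -/
def Rel (p p' : V) : Prop :=
  (p ∈ nbr G J X ∧ p' ∈ leaves G J X p) ∨ (p ∈ far G J X ∧ p ∉ allLeaves G J X ∧ p' = p)

variable (G J X) in
/-- THE STAR GRAPH `G'`: `G[A]` with every star `M_v` contracted onto its centre `v ∈ N`
(vertices outside `R` are isolated). [cite: ConnerydGhannanePang2025, Lemma 6.8 (proof via [CdRNPR25, Lemma 5.4 proof])] -/
def starGraph : SimpleGraph V where
  Adj p q := p ≠ q ∧ p ∈ reps G J X ∧ q ∈ reps G J X ∧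
    ∃ p' q', Rel G J X p p' ∧ Rel G J X q q' ∧ G.Adj p' q'
  symm := ⟨fun _ _ ⟨hne, hp, hq, p', q', hpp', hqq', h⟩ => ⟨hne.symm, hq, hp, q', p', hqq', hpp', h.symm⟩⟩
  loopless := ⟨fun _ h => h.1 rfl⟩

/-- Classical decidability of adjacency in `G'`. [folklore] -/
noncomputable instance starGraph_decidableRel : DecidableRel (starGraph G J X).Adj :=
  Classical.decRel _

/-- Represented vertices lie in `A`. [folklore] -/
theorem mem_far_of_rel {p p' : V} (h : Rel G J X p p') : p' ∈ far G J X := by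
  rcases h with ⟨-, hp'⟩ | ⟨hp, -, rfl⟩
  · exact (mem_leaves.1 hp').1
  · exact hp

/-- The centre of a represented vertex is its representative. [folklore] -/
theorem centre_eq_of_rel (hJ : IsClosed G J) {p p' : V} (h : Rel G J X p p') : centre G J X p' = p := by
  rcases h with ⟨hp, hp'⟩ | ⟨-, hp, rfl⟩
  · exact centre_eq hJ hp hp'
  · exact centre_of_not_mem hp

/-- Every vertex of `A` is represented by its centre, which is a representative. [folklore] -/
theorem rel_centre (hJ : IsClosed G J) {z : V} (hz : z ∈ far G J X) :
    centre G J X z ∈ reps G J X ∧ Rel G J X (centre G J X z) z := by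
  by_cases h : z ∈ allLeaves G J X
  · obtain ⟨v, hv, hzv⟩ := mem_allLeaves.1 h
    rw [centre_eq hJ hv hzv]
    exact ⟨Finset.mem_union_right _ hv, Or.inl ⟨hv, hzv⟩⟩
  · rw [centre_of_not_mem h]
    exact ⟨Finset.mem_union_left _ (Finset.mem_sdiff.2 ⟨hz, h⟩), Or.inr ⟨hz, h, rfl⟩⟩

/-- Representatives lie in `X`. [folklore] -/
theorem reps_subset (hJ : IsClosed G J) : reps G J X ⊆ X := by
  have _ := hJ
  intro p hp
  rcases Finset.mem_union.1 hp with h | h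
  · exact (mem_far.1 (Finset.mem_sdiff.1 h).1).1
  · exact (mem_nbr.1 h).1

section Sparse

variable [Fintype V]

/-- **The star graph inherits sparsity** [CdRNPR, (5.1)–(5.2)]: if `G` is `(ℓ, ε)`-sparse,
`|X| ≤ ℓ` and all degrees are `≤ Δ`, then `G'` is `(|V|, ε(Δ+1))`-sparse.  (For `T' ⊆ R` let `T`
be `T'` together with the stars of its members of `N`; then `|T| ≤ |T'| + s` and
`|E_G(T)| ≥ |E_{G'}(T')| + s`, `s ≤ Δ|T'|` the number of added leaves: star edges plus one
`G`-witness per `G'`-edge, all distinct.) [cite: ConnerydGhannanePang2025, Lemma 6.8 (proof via [CdRNPR25, Lemma 6.5])] -/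
theorem starGraph_isSparse (hJ : IsClosed G J) {ℓ : ℕ} {ε : ℝ} (hε : 0 ≤ ε) (hG : IsSparse G ℓ ε)
    (hX : X.card ≤ ℓ) {Δ : ℕ} (hΔ : ∀ v, G.degree v ≤ Δ) :
    IsSparse (starGraph G J X) (Fintype.card V) (ε * (Δ + 1)) := by
  classical
  intro T' _
  -- restrict to representatives
  set T₀ := T'.filter (· ∈ reps G J X) with hT₀
  have hT₀T' : T₀ ⊆ T' := Finset.filter_subset _ _
  have hE' : edgesIn (starGraph G J X) T' ⊆ edgesIn (starGraph G J X) T₀ := by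
    intro e he
    rw [mem_edgesIn] at he ⊢
    refine ⟨he.1, fun a ha => Finset.mem_filter.2 ⟨he.2 a ha, ?_⟩⟩
    induction e using Sym2.ind with
    | h p q =>
      have hadj : (starGraph G J X).Adj p q := he.1
      rcases Sym2.mem_iff.1 ha with rfl | rfl
      · exact hadj.2.1
      · exact hadj.2.2.1
  -- the leaves added to `T₀`
  set L := (T₀.filter (· ∈ nbr G J X)).biUnion (leaves G J X) with hL
  set T := T₀ ∪ L with hT
  have hTX : T ⊆ X := by
    intro z hz
    rcases Finset.mem_union.1 hz with h | h
    · exact reps_subset hJ (Finset.mem_filter.1 h).2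
    · obtain ⟨v, -, hzv⟩ := Finset.mem_biUnion.1 h
      exact (mem_far.1 (mem_leaves.1 hzv).1).1
  have hLfar : ∀ w ∈ L, ∃ v ∈ T₀, v ∈ nbr G J X ∧ w ∈ leaves G J X v := by
    intro w hw
    obtain ⟨v, hv, hwv⟩ := Finset.mem_biUnion.1 hw
    exact ⟨v, (Finset.mem_filter.1 hv).1, (Finset.mem_filter.1 hv).2, hwv⟩
  -- `s = |L| ≤ Δ |T₀|`
  have hLcard : (L.card : ℝ) ≤ Δ * T₀.card := by
    have h1 : L.card ≤ ∑ v ∈ T₀.filter (· ∈ nbr G J X), (leaves G J X v).card := Finset.card_biUnion_le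
    have h2 : ∀ v ∈ T₀.filter (· ∈ nbr G J X), (leaves G J X v).card ≤ Δ := by
      intro v _
      refine le_trans (Finset.card_le_card ?_) (hΔ v)
      intro w hw
      rw [SimpleGraph.mem_neighborFinset]
      exact (mem_leaves.1 hw).2
    have h3 : L.card ≤ Δ * T₀.card :=
      calc L.card ≤ ∑ v ∈ T₀.filter (· ∈ nbr G J X), (leaves G J X v).card := h1
        _ ≤ ∑ _v ∈ T₀.filter (· ∈ nbr G J X), Δ := Finset.sum_le_sum h2
        _ = Δ * (T₀.filter (· ∈ nbr G J X)).card := by rw [Finset.sum_const, smul_eq_mul, mul_comm]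
        _ ≤ Δ * T₀.card := Nat.mul_le_mul_left _ (Finset.card_le_card (Finset.filter_subset _ _))
    exact_mod_cast h3
  -- star edges
  set S := L.image (fun w => s(centre G J X w, w)) with hS
  have hScard : S.card = L.card := by
    refine Finset.card_image_of_injOn fun w hw w' hw' h => ?_
    obtain ⟨v, -, hv, hwv⟩ := hLfar w hw
    obtain ⟨v', -, hv', hw'v'⟩ := hLfar w' hw'
    have h' : s(centre G J X w, w) = s(centre G J X w', w') := h
    rw [centre_eq hJ hv hwv, centre_eq hJ hv' hw'v'] at h'
    rcases Sym2.eq_iff.1 h' with ⟨-, h⟩ | ⟨rfl, rfl⟩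
    · exact h
    · exact absurd (mem_leaves.1 hw'v').1 (not_mem_far_of_mem_nbr hv)
  have hSsub : S ⊆ edgesIn G T := by
    intro e he
    obtain ⟨w, hw, rfl⟩ := Finset.mem_image.1 he
    obtain ⟨v, hvT₀, hv, hwv⟩ := hLfar w hw
    rw [centre_eq hJ hv hwv, mem_edgesIn]
    refine ⟨(mem_leaves.1 hwv).2, fun a ha => ?_⟩
    rcases Sym2.mem_iff.1 ha with rfl | rfl
    · exact Finset.mem_union_left _ hvT₀
    · exact Finset.mem_union_right _ hw
  -- witnesses of the `G'`-edges
  have hwit : ∀ e ∈ edgesIn (starGraph G J X) T₀,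
      ∃ e' ∈ edgesIn G T, Sym2.map (centre G J X) e' = e ∧ e' ∉ S := by
    intro e he
    rw [mem_edgesIn] at he
    obtain ⟨he, heT⟩ := he
    induction e using Sym2.ind with
    | h p q =>
      obtain ⟨hne, -, -, p', q', hpp', hqq', hadj⟩ : (starGraph G J X).Adj p q := he
      refine ⟨s(p', q'), ?_, ?_, ?_⟩
      · rw [mem_edgesIn]
        refine ⟨hadj, fun a ha => ?_⟩
        have hmemT : ∀ {r r'}, Rel G J X r r' → r ∈ T₀ → r' ∈ T := by
          intro r r' hr hrT
          rcases hr with ⟨hrN, hr'⟩ | ⟨-, -, rfl⟩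
          · exact Finset.mem_union_right _
              (Finset.mem_biUnion.2 ⟨r, Finset.mem_filter.2 ⟨hrT, hrN⟩, hr'⟩)
          · exact Finset.mem_union_left _ hrT
        rcases Sym2.mem_iff.1 ha with rfl | rfl
        · exact hmemT hpp' (heT p (Sym2.mem_mk_left p q))
        · exact hmemT hqq' (heT q (Sym2.mem_mk_right p q))
      · rw [Sym2.map_mk, centre_eq_of_rel hJ hpp', centre_eq_of_rel hJ hqq']
      · intro hmem
        obtain ⟨w, hw, hweq⟩ := Finset.mem_image.1 hmem
        obtain ⟨v, -, hv, hwv⟩ := hLfar w hw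
        have hmap : Sym2.map (centre G J X) (s(centre G J X w, w)) = s(p, q) := by
          rw [hweq, Sym2.map_mk, centre_eq_of_rel hJ hpp', centre_eq_of_rel hJ hqq']
        rw [Sym2.map_mk, centre_eq hJ hv hwv,
          centre_of_not_mem (fun h => not_mem_far_of_mem_nbr hv
            (mem_far_of_rel (G := G) (J := J) (X := X) (Or.inl ⟨hv, ?_⟩))), Sym2.eq_iff] at hmap
        · rcases hmap with ⟨rfl, rfl⟩ | ⟨rfl, rfl⟩ <;> exact hne rfl
        · obtain ⟨v₀, hv₀, hvv₀⟩ := mem_allLeaves.1 h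
          exact absurd (mem_leaves.1 hvv₀).1 (not_mem_far_of_mem_nbr hv)
  choose! wit hwitT hwitmap hwitS using hwit
  set W := (edgesIn (starGraph G J X) T₀).image wit with hW
  have hWcard : W.card = (edgesIn (starGraph G J X) T₀).card :=
    Finset.card_image_of_injOn fun e he e' he' h => by
      rw [← hwitmap e he, ← hwitmap e' he']
      exact congrArg _ h
  have hWsub : W ⊆ edgesIn G T := by
    intro e' he'
    obtain ⟨e, he, rfl⟩ := Finset.mem_image.1 he'
    exact hwitT e he
  have hdisj : Disjoint S W := by
    rw [Finset.disjoint_right]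
    intro e' he'
    obtain ⟨e, he, rfl⟩ := Finset.mem_image.1 he'
    exact hwitS e he
  -- counting
  have hcount : L.card + (edgesIn (starGraph G J X) T₀).card ≤ (edgesIn G T).card := by
    rw [← hScard, ← hWcard, ← Finset.card_union_of_disjoint hdisj]
    exact Finset.card_le_card (Finset.union_subset hSsub hWsub)
  have hTcard : T.card ≤ T₀.card + L.card := Finset.card_union_le _ _
  have hsparse : ((edgesIn G T).card : ℝ) ≤ (1 + ε) * T.card := hG T ((Finset.card_le_card hTX).trans hX)
  have hmain : ((edgesIn (starGraph G J X) T₀).card : ℝ) ≤ (1 + ε * (Δ + 1)) * T₀.card := by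
    have h1 : ((edgesIn (starGraph G J X) T₀).card : ℝ) + L.card ≤ (1 + ε) * (T₀.card + L.card) := by
      have hc : ((L.card + (edgesIn (starGraph G J X) T₀).card : ℕ) : ℝ) ≤ (edgesIn G T).card := by
        exact_mod_cast hcount
      have ht : ((T.card : ℕ) : ℝ) ≤ T₀.card + L.card := by exact_mod_cast hTcard
      push_cast at hc
      nlinarith
    nlinarith [hLcard, hε, (Nat.cast_nonneg T₀.card : (0 : ℝ) ≤ T₀.card)]
  calc ((edgesIn (starGraph G J X) T').card : ℝ)
      ≤ (edgesIn (starGraph G J X) T₀).card := by exact_mod_cast Finset.card_le_card hE'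
    _ ≤ (1 + ε * (Δ + 1)) * T₀.card := hmain
    _ ≤ (1 + ε * (Δ + 1)) * T'.card := by
        have : (T₀.card : ℝ) ≤ T'.card := by exact_mod_cast Finset.card_le_card hT₀T'
        have hpos : (0 : ℝ) ≤ 1 + ε * (Δ + 1) := by positivity
        exact mul_le_mul_of_nonneg_left this hpos

/-- **The monochromatic-star colouring** [CdRNPR, proof of Lemma 5.4]: if moreover
`ε(Δ+1) < 1/2`, there is a proper `3`-colouring `ρ` of `G[A]` in which every star `M_v`,
`v ∈ N`, is monochromatic with colour `κ v` (colour `G'` by Lemma 6.5 =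
`IsSparse.exists_proper_three` and give each vertex of `A` the colour of its centre).
[cite: ConnerydGhannanePang2025, Lemma 6.8 (proof via [CdRNPR25, Lemma 6.5])] -/
theorem exists_starColouring (hJ : IsClosed G J) {ℓ : ℕ} {ε : ℝ} (hε : 0 ≤ ε) (hG : IsSparse G ℓ ε)
    (hX : X.card ≤ ℓ) {Δ : ℕ} (hΔ : ∀ v, G.degree v ≤ Δ) (hεΔ : ε * (Δ + 1) < 1 / 2) :
    ∃ ρ κ : V → Fin 3, (∀ z ∈ far G J X, ∀ z' ∈ far G J X, G.Adj z z' → ρ z ≠ ρ z') ∧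
      ∀ v ∈ nbr G J X, ∀ w ∈ leaves G J X v, ρ w = κ v := by
  obtain ⟨c, hc⟩ := (starGraph_isSparse hJ hε hG hX hΔ).exists_proper_three hεΔ (reps G J X)
    (Finset.card_le_univ _)
  refine ⟨fun z => c (centre G J X z), c, fun z hz z' hz' hadj => ?_, fun v hv w hw => ?_⟩
  · obtain ⟨hp, hpz⟩ := rel_centre hJ hz
    obtain ⟨hq, hqz'⟩ := rel_centre hJ hz'
    refine hc _ hp _ hq ⟨fun heq => ?_, hp, hq, z, z', hpz, hqz', hadj⟩
    -- equal centres: both leaves of the same star, or a vertex adjacent to itself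
    rcases hpz with ⟨hv, hzv⟩ | ⟨-, -, hzp⟩ <;> rcases hqz' with ⟨hv', hz'v'⟩ | ⟨hz'far, -, hz'q⟩
    · exact leaves_independent hJ hv hzv (heq ▸ hz'v') hadj
    · rw [← heq] at hz'q
      exact not_mem_far_of_mem_nbr hv (hz'q ▸ hz')
    · rw [heq] at hzp
      exact not_mem_far_of_mem_nbr hv' (hzp ▸ hz)
    · exact G.ne_of_adj hadj (hzp.trans (heq.trans hz'q.symm))
  · show c (centre G J X w) = c v
    rw [centre_eq hJ hv hw]

end Sparse

end ConnerydGhannanePang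

end Literature.ModelTheory.FiniteModelTheory
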